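import Literature.Analysis.FluidPDE.KochTataruPointwise
import Mathlib.MeasureTheory.Integral.Gamma
import Mathlib.MeasureTheory.Group.Integral
import Mathlib.Analysis.SpecialFunctions.ImproperIntegrals
import Mathlib.MeasureTheory.Function.L2Space
import HarnessLib

/-!
# The Oseen–Koch–Tataru kernel integrated along lines: data independent of one coordinate

Analysis/FluidPDE support file (everything proved; no definitions, no named facts) for the
Liouville step of the proof of Koch–Nadirashvili–Seregin–Šverák 2009, Theorem 6.2
(`Literature.Analysis.FluidPDE.KNSS2009_typeI_rate_liouville`, `KNSSTypeIRateCore`; Acta Math.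
203 (2009) = arXiv:0709.3599, p. 13: the blow-up limit `w` "is independent of the
`x₂`-variable", and the planar Liouville theorem is applied "to the field `(w₁, w₃)`"). In the
tree KNSS's mild solutions are rendered by the Oseen integral equation
`u(t) = e^{(t−s)Δ}u(s) − B_s(u, u)(t)` with the closed kernel `K(τ, z)[a, b]` of `e^{τΔ}P∇·` on
rank-one tensors (`Literature.Analysis.FluidPDE.oseenKernel`, Koch–Tataru 2001, (8):
`K = −(⟪z,a⟫/2τ) G_τ b + A (⟪z,a⟫b + ⟪a,b⟫z + ⟪z,b⟫a) − B ⟪z,a⟫⟪z,b⟫ z` with the Gaussian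
weights `A = ∫_τ^∞ G_s/(4s²) ds`, `B = ∫_τ^∞ G_s/(8s³) ds`). For tensors `u ⊗ v` that do not
depend on one coordinate, `e^{τΔ}P∇·(u ⊗ v)` only sees the planar divergence; at the level of
the closed kernel this is a statement about the integrals of `K` along the lines parallel to a
unit vector `e`, which this file proves:

* `§ Gaussian`, `§ Lines`: `∫ x² e^{−bx²} dx = √(π/b)/(2b)`; for `z' ⊥ e`,
  `G_s(z' + re) = (4πs)^{−d/2} e^{−‖z'‖²/4s} e^{−r²/4s}`, whence
  `∫ G_s(z' + re) dr` and `∫ r² G_s(z' + re) dr = 2s ∫ G_s(z' + re) dr`;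
* `§ Weights`: Fubini for the weights along a line and **the moment identity**
  `∫ (A(σ, z' + re) − r² B(σ, z' + re)) dr = 0`
  (`integral_oseenWeightA_sub_sq_mul_oseenWeightB_line`: both sides equal
  `∫_σ^∞ (4πs)^{−d/2} e^{−‖z'‖²/4s} √(4πs)/(4s²) ds`, because `2s/(8s³) = 1/(4s²)`);
* `§ Kernel`: the even parts in `r` of `K(σ, z' + re)[e, b]` and of the component orthogonal
  to `e` of `K(σ, z' + re)[a, e]` are multiples of `A − r²B`
  (`oseenKernel_line_reflect_add_left`, `inner_oseenKernel_line_reflect_add_right`, by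
  `module`/`ring` on the closed form), the odd parts integrate to zero, and so
  `∫ K(σ, z' + re)[e, b] dr = 0` (`integral_oseenKernel_line_left`) and
  `⟪∫ K(σ, z' + re)[a, e] dr, v⟫ = 0` for `v ⊥ e` (`inner_integral_oseenKernel_line_right`),
  the kernel being integrable along lines by Koch–Tataru's bound (14);
* `§ R3`: on `ℝ³ = EuclideanSpace ℝ (Fin 3)` with `e = e₁` (Lean coordinate `1`): a
  volume-preserving parametrisation `ℝ³ ≃ ℝ × ℝ²` by the lines `r ↦ (w₀, r, w₁)`
  (`exists_measurableEquiv_line`, Mathlib's `MeasurableEquiv.piFinSuccAbove`), Fubini along these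
  lines, and the consequences for bounded measurable data invariant under `y ↦ y + δe₁`:
  `∫ K(σ, x − y)[g(y)e₁, c(y)] dy = 0` (`integral_oseenKernel_sub_smul_single_left`:
  `e^{σΔ}P∇·((g e₁) ⊗ c) = 0`, the divergence `∂₁(g c)` vanishing) and
  `⟪∫ K(σ, x − y)[a(y), g(y)e₁] dy, v⟫ = 0` for `v ⊥ e₁`
  (`inner_integral_oseenKernel_sub_smul_single_right`: `e^{σΔ}P∇·(a ⊗ g e₁) ∥ e₁`).

These feed the two halves of the Liouville step of KNSS Theorem 6.2
(`KNSSTypeIRateLiouville`): the Duhamel term of an axial field `W₁e₁` independent of `x₁`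
vanishes, and the planar components of the Duhamel term of `β(t) + W₁e₁` vanish (Remark 6.1 for
such fields).

## Mathlib / tree search

Tree: `oseenKernel`, `oseenWeightA/B`, bilinearity (`KochTataru`); the bounds
`exists_norm_oseenKernel_le`, `exists_oseenWeightA/B_le`, `integrable_add_norm_sq_rpow_neg`,
`measurable_oseenKernel(_left)` (`KochTataruKernel`), `AEMeasurable.oseenKernel_comp`
(`KochTataruPointwise`); oddness `oseenKernel_neg` and `∫ K dz = 0` (`KNSSRemark61`, not
imported: the reflections here are along one direction only); the cylindrical splitting at the
index `2` (`CylindricalIntegration.cylSplit`, the model for `exists_measurableEquiv_line`).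
Mathlib: `integral_gaussian`, `integral_rpow_mul_exp_neg_mul_rpow`, `Real.Gamma_one_half_eq`,
`integral_comp_abs`, `integrable_prod_iff`, `integral_prod(_symm)`, `integral_neg_eq_self`,
`integral_sub_left_eq_self`, `volume_preserving_piFinSuccAbove`,
`EuclideanSpace.volume_preserving_symm_measurableEquiv_toLp`, `PiLp.volume_preserving_toLp`.

## References

* H. Koch, D. Tataru, *Well-posedness for the Navier–Stokes equations*, Adv. Math. 157 (2001)
  22–35, §2 (8) (the kernel), §3 (14) (its bound). [KochTataruAdvMath2001]
* G. Koch, N. Nadirashvili, G. Seregin, V. Šverák, Acta Math. 203 (2009) 83–105 =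
  arXiv:0709.3599, proof of Theorem 6.2, p. 13. [KochNadirashviliSereginSverak2009]
-/

noncomputable section

open MeasureTheory Set Function Filter Real WithLp
open scoped RealInnerProductSpace

namespace Literature.Analysis.FluidPDE

/-! ## A one-dimensional Gaussian moment -/

section Gaussian

/-- **Second Gaussian moment on the line**: `∫ x² e^{−bx²} dx = √(π/b)/(2b)` for `b > 0`
(from Mathlib's `∫₀^∞ x^q e^{−bx^p}` in terms of `Γ`, with `Γ(3/2) = √π/2`). [folklore] -/
theorem integral_sq_mul_exp_neg_mul_sq {b : ℝ} (hb : 0 < b) :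
    ∫ x : ℝ, x ^ 2 * Real.exp (-b * x ^ 2) = √(π / b) / (2 * b) := by
  have h := integral_comp_abs (f := fun u => u ^ 2 * Real.exp (-b * u ^ 2))
  simp only [sq_abs] at h
  rw [h]
  have h2 := integral_rpow_mul_exp_neg_mul_rpow (p := 2) (q := 2) two_pos (by norm_num) hb
  have h2' : ∫ x in Ioi (0 : ℝ), x ^ 2 * Real.exp (-b * x ^ 2) =
      b ^ (-(2 + 1) / 2 : ℝ) * (1 / 2) * Real.Gamma ((2 + 1) / 2) := by
    rw [← h2]
    refine setIntegral_congr_fun measurableSet_Ioi fun x _ => ?_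
    rw [Real.rpow_two]
  rw [h2']
  have hG : Real.Gamma ((2 + 1) / 2) = √π / 2 := by
    rw [show ((2 : ℝ) + 1) / 2 = 1 / 2 + 1 by norm_num, Real.Gamma_add_one (by norm_num),
      Real.Gamma_one_half_eq]
    ring
  rw [hG, show (-(2 + 1) / 2 : ℝ) = -(3 / 2) by norm_num, Real.rpow_neg hb.le,
    show (3 / 2 : ℝ) = 1 + 1 / 2 by norm_num, Real.rpow_add hb, Real.rpow_one,
    ← Real.sqrt_eq_rpow, Real.sqrt_div Real.pi_pos.le]
  field_simp

/-- `x² e^{−bx²}` is integrable on `ℝ` for `b > 0`. [folklore] -/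
theorem integrable_sq_mul_exp_neg_mul_sq {b : ℝ} (hb : 0 < b) :
    Integrable fun x : ℝ => x ^ 2 * Real.exp (-b * x ^ 2) := by
  have h := integrable_rpow_mul_exp_neg_mul_sq hb (s := 2) (by norm_num)
  refine h.congr (Eventually.of_forall fun x => ?_)
  simp only [Real.rpow_two]

end Gaussian

variable {E : Type*} [NormedAddCommGroup E] [InnerProductSpace ℝ E]

/-! ## The heat kernel and the Gaussian weights along a line -/

section Lines

variable {e z' : E}

/-- Pythagoras on the line: `‖z' + re‖² = ‖z'‖² + r²` for `z' ⊥ e`, `‖e‖ = 1`. [folklore] -/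
theorem norm_add_smul_sq_of_inner_eq_zero (he : ‖e‖ = 1) (hz : ⟪z', e⟫ = 0) (r : ℝ) :
    ‖z' + r • e‖ ^ 2 = ‖z'‖ ^ 2 + r ^ 2 := by
  rw [norm_add_sq_real, real_inner_smul_right, hz, norm_smul, he, Real.norm_eq_abs, mul_one,
    sq_abs]
  ring

/-- Reflection along the line preserves the norm: `‖z' − re‖ = ‖z' + re‖` for `z' ⊥ e`.
[folklore] -/
theorem norm_add_neg_smul_of_inner_eq_zero (he : ‖e‖ = 1) (hz : ⟪z', e⟫ = 0) (r : ℝ) :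
    ‖z' + (-r) • e‖ = ‖z' + r • e‖ := by
  have h1 := norm_add_smul_sq_of_inner_eq_zero he hz r
  have h2 := norm_add_smul_sq_of_inner_eq_zero he hz (-r)
  rw [neg_sq] at h2
  nlinarith [norm_nonneg (z' + (-r) • e), norm_nonneg (z' + r • e)]

/-- The heat kernel is radial: it takes equal values at points of equal norm. [folklore] -/
theorem heatKernel_eq_of_norm_eq {x y : E} (h : ‖x‖ = ‖y‖) (t : ℝ) :
    UnboundedOperators.heatKernel t x = UnboundedOperators.heatKernel t y := by
  simp [UnboundedOperators.heatKernel, h]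

/-- The first Gaussian weight is radial. [folklore] -/
theorem oseenWeightA_eq_of_norm_eq {x y : E} (h : ‖x‖ = ‖y‖) (τ : ℝ) :
    oseenWeightA τ x = oseenWeightA τ y := by
  simp [oseenWeightA, heatKernel_eq_of_norm_eq h]

/-- The second Gaussian weight is radial. [folklore] -/
theorem oseenWeightB_eq_of_norm_eq {x y : E} (h : ‖x‖ = ‖y‖) (τ : ℝ) :
    oseenWeightB τ x = oseenWeightB τ y := by
  simp [oseenWeightB, heatKernel_eq_of_norm_eq h]

/-- **The heat kernel on a line parallel to `e` factorises**:
`G_s(z' + re) = (4πs)^{−d/2} e^{−‖z'‖²/4s} · e^{−r²/4s}` for `z' ⊥ e`, `‖e‖ = 1`. [folklore] -/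
theorem heatKernel_add_smul (he : ‖e‖ = 1) (hz : ⟪z', e⟫ = 0) (s r : ℝ) :
    UnboundedOperators.heatKernel s (z' + r • e) =
      (4 * π * s) ^ (-(Module.finrank ℝ E : ℝ) / 2) * Real.exp (-‖z'‖ ^ 2 / (4 * s)) *
        Real.exp (-(1 / (4 * s)) * r ^ 2) := by
  have h : Real.exp (-(‖z'‖ ^ 2 + r ^ 2) / (4 * s)) =
      Real.exp (-‖z'‖ ^ 2 / (4 * s)) * Real.exp (-(1 / (4 * s)) * r ^ 2) := by
    rw [← Real.exp_add]
    congr 1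
    ring
  rw [UnboundedOperators.heatKernel, norm_add_smul_sq_of_inner_eq_zero he hz, h]
  ring

/-- **Mass of the heat kernel along a line**:
`∫ G_s(z' + re) dr = (4πs)^{−d/2} e^{−‖z'‖²/4s} √(4πs)` (`s > 0`). [folklore] -/
theorem integral_heatKernel_line (he : ‖e‖ = 1) (hz : ⟪z', e⟫ = 0) {s : ℝ} (hs : 0 < s) :
    ∫ r : ℝ, UnboundedOperators.heatKernel s (z' + r • e) =
      (4 * π * s) ^ (-(Module.finrank ℝ E : ℝ) / 2) * Real.exp (-‖z'‖ ^ 2 / (4 * s)) *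
        √(4 * π * s) := by
  simp_rw [heatKernel_add_smul he hz, integral_const_mul, integral_gaussian]
  congr 2
  field_simp

/-- **Second moment of the heat kernel along a line**:
`∫ r² G_s(z' + re) dr = 2s · (4πs)^{−d/2} e^{−‖z'‖²/4s} √(4πs)` (`s > 0`). [folklore] -/
theorem integral_sq_mul_heatKernel_line (he : ‖e‖ = 1) (hz : ⟪z', e⟫ = 0) {s : ℝ} (hs : 0 < s) :
    ∫ r : ℝ, r ^ 2 * UnboundedOperators.heatKernel s (z' + r • e) =
      (4 * π * s) ^ (-(Module.finrank ℝ E : ℝ) / 2) * Real.exp (-‖z'‖ ^ 2 / (4 * s)) *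
        √(4 * π * s) * (2 * s) := by
  have hb : 0 < 1 / (4 * s) := by positivity
  simp_rw [heatKernel_add_smul he hz]
  have : ∀ r : ℝ, r ^ 2 * ((4 * π * s) ^ (-(Module.finrank ℝ E : ℝ) / 2) *
      Real.exp (-‖z'‖ ^ 2 / (4 * s)) * Real.exp (-(1 / (4 * s)) * r ^ 2)) =
      (4 * π * s) ^ (-(Module.finrank ℝ E : ℝ) / 2) * Real.exp (-‖z'‖ ^ 2 / (4 * s)) *
        (r ^ 2 * Real.exp (-(1 / (4 * s)) * r ^ 2)) := fun r => by ring
  simp_rw [this, integral_const_mul, integral_sq_mul_exp_neg_mul_sq hb]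
  have h4 : π / (1 / (4 * s)) = 4 * π * s := by field_simp
  rw [h4]
  field_simp
  norm_num

/-- The heat kernel is integrable along a line (`s > 0`). [folklore] -/
theorem integrable_heatKernel_line (he : ‖e‖ = 1) (hz : ⟪z', e⟫ = 0) {s : ℝ} (hs : 0 < s) :
    Integrable fun r : ℝ => UnboundedOperators.heatKernel s (z' + r • e) := by
  simp_rw [heatKernel_add_smul he hz]
  exact (integrable_exp_neg_mul_sq (by positivity)).const_mul _

/-- `r² G_s(z' + re)` is integrable along a line (`s > 0`). [folklore] -/
theorem integrable_sq_mul_heatKernel_line (he : ‖e‖ = 1) (hz : ⟪z', e⟫ = 0) {s : ℝ}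
    (hs : 0 < s) :
    Integrable fun r : ℝ => r ^ 2 * UnboundedOperators.heatKernel s (z' + r • e) := by
  simp_rw [heatKernel_add_smul he hz]
  have h := (integrable_sq_mul_exp_neg_mul_sq (b := 1 / (4 * s)) (by positivity)).const_mul
    ((4 * π * s) ^ (-(Module.finrank ℝ E : ℝ) / 2) * Real.exp (-‖z'‖ ^ 2 / (4 * s)))
  refine h.congr (Eventually.of_forall fun r => ?_)
  simp only
  ring

/-- The common value `Φ(s) = (4πs)^{−d/2} e^{−‖z'‖²/4s} √(4πs)/(4s²)` of the two fibre
integrals of the weights is dominated on `s > 0` by `(4π)^{(1−d)/2}/4 · s^{−(d+3)/2}`.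
[folklore] -/
theorem fiberWeight_le {s : ℝ} (hs : 0 < s) (z' : E) :
    (4 * π * s) ^ (-(Module.finrank ℝ E : ℝ) / 2) * Real.exp (-‖z'‖ ^ 2 / (4 * s)) *
        √(4 * π * s) / (4 * s ^ 2) ≤
      (4 * π) ^ ((1 - (Module.finrank ℝ E : ℝ)) / 2) / 4 *
        s ^ (-(((Module.finrank ℝ E : ℝ)) + 3) / 2) := by
  set d : ℝ := (Module.finrank ℝ E : ℝ) with hd
  have h4π : 0 < 4 * π := by positivity
  have h4πs : 0 < 4 * π * s := by positivity
  have hexp : Real.exp (-‖z'‖ ^ 2 / (4 * s)) ≤ 1 := by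
    rw [Real.exp_le_one_iff, neg_div]
    exact neg_nonpos.2 (by positivity)
  have hsqrt : √(4 * π * s) = (4 * π * s) ^ (1 / 2 : ℝ) := Real.sqrt_eq_rpow _
  have hcomb : (4 * π * s) ^ (-d / 2) * √(4 * π * s) =
      (4 * π) ^ ((1 - d) / 2) * s ^ ((1 - d) / 2) := by
    rw [hsqrt, ← Real.rpow_add h4πs, Real.mul_rpow h4π.le hs.le]
    congr 1 <;> ring_nf
  have hpow : s ^ ((1 - d) / 2) / (4 * s ^ 2) = s ^ (-(d + 3) / 2) / 4 := by
    rw [show (-(d + 3) / 2 : ℝ) = (1 - d) / 2 - 2 by ring, Real.rpow_sub hs,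
      show s ^ (2 : ℝ) = s ^ 2 from Real.rpow_two s]
    ring
  calc (4 * π * s) ^ (-d / 2) * Real.exp (-‖z'‖ ^ 2 / (4 * s)) * √(4 * π * s) / (4 * s ^ 2)
      = Real.exp (-‖z'‖ ^ 2 / (4 * s)) *
          ((4 * π * s) ^ (-d / 2) * √(4 * π * s)) / (4 * s ^ 2) := by ring
    _ = Real.exp (-‖z'‖ ^ 2 / (4 * s)) *
          ((4 * π) ^ ((1 - d) / 2) * (s ^ ((1 - d) / 2) / (4 * s ^ 2))) := by
        rw [hcomb]; ring
    _ ≤ 1 * ((4 * π) ^ ((1 - d) / 2) * (s ^ ((1 - d) / 2) / (4 * s ^ 2))) := by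
        gcongr
    _ = (4 * π) ^ ((1 - d) / 2) / 4 * s ^ (-(d + 3) / 2) := by rw [hpow]; ring

end Lines

/-! ## The Gaussian weights integrated along a line: Fubini and the moment identity -/

section Weights

variable {e z' : E} {σ : ℝ}

/-- The integrand of the first weight along a line, `(s, r) ↦ G_s(z' + re)/(4s²)`, is
integrable on `(σ, ∞) × ℝ` for `σ > 0` (sections Gaussian in `r`; the fibre integrals
`Φ(s) = O(s^{−(d+3)/2})`). [folklore] -/
theorem integrable_heatKernel_div_prod_line (he : ‖e‖ = 1) (hz : ⟪z', e⟫ = 0) (hσ : 0 < σ) :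
    Integrable (fun p : ℝ × ℝ =>
        UnboundedOperators.heatKernel p.1 (z' + p.2 • e) / (4 * p.1 ^ 2))
      ((volume.restrict (Ioi σ)).prod volume) := by
  set F : ℝ × ℝ → ℝ := fun p => UnboundedOperators.heatKernel p.1 (z' + p.2 • e) / (4 * p.1 ^ 2)
    with hF
  have hFeq : F = fun p : ℝ × ℝ => (4 * π * p.1) ^ (-(Module.finrank ℝ E : ℝ) / 2) *
      Real.exp (-‖z'‖ ^ 2 / (4 * p.1)) * Real.exp (-(1 / (4 * p.1)) * p.2 ^ 2) /
        (4 * p.1 ^ 2) := by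
    funext p
    simp only [hF, heatKernel_add_smul he hz]
  have hmeas : Measurable F := by
    rw [hFeq]
    fun_prop
  rw [integrable_prod_iff hmeas.aestronglyMeasurable]
  refine ⟨(ae_restrict_iff' measurableSet_Ioi).2 (Eventually.of_forall fun s hs => by
    simp only [hF]
    exact (integrable_heatKernel_line he hz (hσ.trans hs)).div_const _), ?_⟩
  have hval : ∀ s ∈ Ioi σ, ∫ r, ‖F (s, r)‖ =
      (4 * π * s) ^ (-(Module.finrank ℝ E : ℝ) / 2) * Real.exp (-‖z'‖ ^ 2 / (4 * s)) *
        √(4 * π * s) / (4 * s ^ 2) := by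
    intro s hs
    have hs0 : 0 < s := hσ.trans hs
    have hnn : ∀ r, ‖F (s, r)‖ = F (s, r) := fun r =>
      Real.norm_of_nonneg (div_nonneg (UnboundedOperators.heatKernel_pos hs0 _).le
        (by positivity))
    simp_rw [hnn, hF]
    rw [integral_div, integral_heatKernel_line he hz hs0]
  refine Integrable.mono' (g := fun s => (4 * π) ^ ((1 - (Module.finrank ℝ E : ℝ)) / 2) / 4 *
      s ^ (-((Module.finrank ℝ E : ℝ) + 3) / 2))
    ((integrableOn_Ioi_rpow_of_lt
      (by linarith [(Nat.cast_nonneg _ : (0 : ℝ) ≤ Module.finrank ℝ E)]) hσ).const_mul _)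
    hmeas.aestronglyMeasurable.norm.integral_prod_right' ?_
  refine (ae_restrict_iff' measurableSet_Ioi).2 (Eventually.of_forall fun s hs => ?_)
  rw [Real.norm_of_nonneg (integral_nonneg fun r => norm_nonneg _), hval s hs]
  exact fiberWeight_le (hσ.trans hs) z'

/-- The integrand of `r² B` along a line, `(s, r) ↦ r² G_s(z' + re)/(8s³)`, is integrable on
`(σ, ∞) × ℝ` for `σ > 0` (same fibre integrals `Φ(s)`). [folklore] -/
theorem integrable_sq_mul_heatKernel_div_prod_line (he : ‖e‖ = 1) (hz : ⟪z', e⟫ = 0)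
    (hσ : 0 < σ) :
    Integrable (fun p : ℝ × ℝ =>
        p.2 ^ 2 * UnboundedOperators.heatKernel p.1 (z' + p.2 • e) / (8 * p.1 ^ 3))
      ((volume.restrict (Ioi σ)).prod volume) := by
  set F : ℝ × ℝ → ℝ := fun p =>
    p.2 ^ 2 * UnboundedOperators.heatKernel p.1 (z' + p.2 • e) / (8 * p.1 ^ 3) with hF
  have hFeq : F = fun p : ℝ × ℝ => p.2 ^ 2 * ((4 * π * p.1) ^ (-(Module.finrank ℝ E : ℝ) / 2) *
      Real.exp (-‖z'‖ ^ 2 / (4 * p.1)) * Real.exp (-(1 / (4 * p.1)) * p.2 ^ 2)) /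
        (8 * p.1 ^ 3) := by
    funext p
    simp only [hF, heatKernel_add_smul he hz]
  have hmeas : Measurable F := by
    rw [hFeq]
    fun_prop
  rw [integrable_prod_iff hmeas.aestronglyMeasurable]
  refine ⟨(ae_restrict_iff' measurableSet_Ioi).2 (Eventually.of_forall fun s hs => by
    simp only [hF]
    exact (integrable_sq_mul_heatKernel_line he hz (hσ.trans hs)).div_const _), ?_⟩
  have hval : ∀ s ∈ Ioi σ, ∫ r, ‖F (s, r)‖ =
      (4 * π * s) ^ (-(Module.finrank ℝ E : ℝ) / 2) * Real.exp (-‖z'‖ ^ 2 / (4 * s)) *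
        √(4 * π * s) / (4 * s ^ 2) := by
    intro s hs
    have hs0 : 0 < s := hσ.trans hs
    have hnn : ∀ r, ‖F (s, r)‖ = F (s, r) := fun r =>
      Real.norm_of_nonneg (div_nonneg (mul_nonneg (sq_nonneg _)
        (UnboundedOperators.heatKernel_pos hs0 _).le) (by positivity))
    simp_rw [hnn, hF]
    rw [integral_div, integral_sq_mul_heatKernel_line he hz hs0]
    field_simp
    norm_num
  refine Integrable.mono' (g := fun s => (4 * π) ^ ((1 - (Module.finrank ℝ E : ℝ)) / 2) / 4 *
      s ^ (-((Module.finrank ℝ E : ℝ) + 3) / 2))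
    ((integrableOn_Ioi_rpow_of_lt
      (by linarith [(Nat.cast_nonneg _ : (0 : ℝ) ≤ Module.finrank ℝ E)]) hσ).const_mul _)
    hmeas.aestronglyMeasurable.norm.integral_prod_right' ?_
  refine (ae_restrict_iff' measurableSet_Ioi).2 (Eventually.of_forall fun s hs => ?_)
  rw [Real.norm_of_nonneg (integral_nonneg fun r => norm_nonneg _), hval s hs]
  exact fiberWeight_le (hσ.trans hs) z'

/-- **Fibre integral of the first Gaussian weight**: `r ↦ A(σ, z' + re)` is integrable and
`∫ A(σ, z' + re) dr = ∫_σ^∞ (4πs)^{−d/2} e^{−‖z'‖²/4s} √(4πs)/(4s²) ds` (Fubini; `σ > 0`,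
`z' ⊥ e`, `‖e‖ = 1`). [folklore] -/
theorem integral_oseenWeightA_line (he : ‖e‖ = 1) (hz : ⟪z', e⟫ = 0) (hσ : 0 < σ) :
    Integrable (fun r : ℝ => oseenWeightA σ (z' + r • e)) ∧
      ∫ r : ℝ, oseenWeightA σ (z' + r • e) = ∫ s in Ioi σ,
        (4 * π * s) ^ (-(Module.finrank ℝ E : ℝ) / 2) * Real.exp (-‖z'‖ ^ 2 / (4 * s)) *
          √(4 * π * s) / (4 * s ^ 2) := by
  have hF := integrable_heatKernel_div_prod_line he hz hσ
  have heq : (fun r : ℝ => oseenWeightA σ (z' + r • e)) = fun r => ∫ s,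
      UnboundedOperators.heatKernel s (z' + r • e) / (4 * s ^ 2) ∂(volume.restrict (Ioi σ)) :=
    rfl
  refine ⟨by rw [heq]; exact hF.integral_prod_right, ?_⟩
  rw [heq, ← integral_prod_symm _ hF, integral_prod _ hF]
  refine setIntegral_congr_fun measurableSet_Ioi fun s hs => ?_
  simp only
  rw [integral_div, integral_heatKernel_line he hz (hσ.trans hs)]

/-- **Fibre integral of `r² B`**: `r ↦ r² B(σ, z' + re)` is integrable with the *same*
integral as `A` (`∫ r² e^{−r²/4s} dr = 2s ∫ e^{−r²/4s} dr` and `2s/(8s³) = 1/(4s²)`). [folklore] -/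
theorem integral_sq_mul_oseenWeightB_line (he : ‖e‖ = 1) (hz : ⟪z', e⟫ = 0) (hσ : 0 < σ) :
    Integrable (fun r : ℝ => r ^ 2 * oseenWeightB σ (z' + r • e)) ∧
      ∫ r : ℝ, r ^ 2 * oseenWeightB σ (z' + r • e) = ∫ s in Ioi σ,
        (4 * π * s) ^ (-(Module.finrank ℝ E : ℝ) / 2) * Real.exp (-‖z'‖ ^ 2 / (4 * s)) *
          √(4 * π * s) / (4 * s ^ 2) := by
  have hF := integrable_sq_mul_heatKernel_div_prod_line he hz hσ
  have heq : (fun r : ℝ => r ^ 2 * oseenWeightB σ (z' + r • e)) = fun r => ∫ s,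
      r ^ 2 * UnboundedOperators.heatKernel s (z' + r • e) / (8 * s ^ 3)
        ∂(volume.restrict (Ioi σ)) := by
    funext r
    rw [oseenWeightB, ← integral_const_mul]
    refine integral_congr_ae (Eventually.of_forall fun s => ?_)
    simp only
    ring
  refine ⟨by rw [heq]; exact hF.integral_prod_right, ?_⟩
  rw [heq, ← integral_prod_symm _ hF, integral_prod _ hF]
  refine setIntegral_congr_fun measurableSet_Ioi fun s hs => ?_
  have hs0 : 0 < s := hσ.trans hs
  simp only
  rw [integral_div, integral_sq_mul_heatKernel_line he hz hs0]
  field_simp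
  norm_num

/-- **The Gaussian-moment identity of the Oseen weights along a line**:
`∫ (A(σ, z' + re) − r² B(σ, z' + re)) dr = 0` for `z' ⊥ e`, `‖e‖ = 1`, `σ > 0`. This is the
identity that makes the Leray-projector part of the kernel of `e^{σΔ}P∇·` blind, after
integration along the lines parallel to `e`, to the components it must not see. [folklore] -/
theorem integral_oseenWeightA_sub_sq_mul_oseenWeightB_line (he : ‖e‖ = 1) (hz : ⟪z', e⟫ = 0)
    (hσ : 0 < σ) :
    ∫ r : ℝ, (oseenWeightA σ (z' + r • e) - r ^ 2 * oseenWeightB σ (z' + r • e)) = 0 := by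
  obtain ⟨hA, hAv⟩ := integral_oseenWeightA_line he hz hσ
  obtain ⟨hB, hBv⟩ := integral_sq_mul_oseenWeightB_line he hz hσ
  rw [integral_sub hA hB, hAv, hBv, sub_self]

end Weights

/-! ## The kernel along a line -/

section Kernel

variable {e z' : E} {σ : ℝ}

/-- **Reflection along the line, divergence slot on the line.** For `z' ⊥ e`, `‖e‖ = 1`:
`K(σ, z' − re)[e, b] + K(σ, z' + re)[e, b] = 2(A − r²B)(σ, z' + re) (⟪e, b⟫ z' + ⟪z', b⟫ e)`
— twice the even part in `r` of the kernel with its divergence slot along the line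
(Koch–Tataru 2001, (8), the closed form; the Gaussian weights are radial). [cite: KochTataruAdvMath2001, §2 (8)] -/
theorem oseenKernel_line_reflect_add_left (he : ‖e‖ = 1) (hz : ⟪z', e⟫ = 0) (σ r : ℝ)
    (b : E) :
    oseenKernel σ (z' + (-r) • e) e b + oseenKernel σ (z' + r • e) e b =
      (2 * (oseenWeightA σ (z' + r • e) - r ^ 2 * oseenWeightB σ (z' + r • e))) •
        (⟪e, b⟫ • z' + ⟪z', b⟫ • e) := by
  have hn : ‖z' + (-r) • e‖ = ‖z' + r • e‖ := norm_add_neg_smul_of_inner_eq_zero he hz r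
  have hee : ⟪e, e⟫ = 1 := by rw [real_inner_self_eq_norm_sq, he, one_pow]
  simp only [oseenKernel, heatKernel_eq_of_norm_eq hn, oseenWeightA_eq_of_norm_eq hn,
    oseenWeightB_eq_of_norm_eq hn, inner_add_left, real_inner_smul_left, hz, hee]
  module

/-- **Reflection along the line, transported slot on the line, tested against `v ⊥ e`.**
For `z' ⊥ e`, `v ⊥ e`, `‖e‖ = 1`:
`⟪K(σ, z' − re)[a, e] + K(σ, z' + re)[a, e], v⟫ = 2 ⟪a, e⟫ ⟪z', v⟫ (A − r²B)(σ, z' + re)`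
(Koch–Tataru 2001, (8)). [cite: KochTataruAdvMath2001, §2 (8)] -/
theorem inner_oseenKernel_line_reflect_add_right (he : ‖e‖ = 1) (hz : ⟪z', e⟫ = 0) {v : E}
    (hv : ⟪v, e⟫ = 0) (σ r : ℝ) (a : E) :
    ⟪oseenKernel σ (z' + (-r) • e) a e + oseenKernel σ (z' + r • e) a e, v⟫ =
      2 * (⟪a, e⟫ * ⟪z', v⟫ *
        (oseenWeightA σ (z' + r • e) - r ^ 2 * oseenWeightB σ (z' + r • e))) := by
  have hn : ‖z' + (-r) • e‖ = ‖z' + r • e‖ := norm_add_neg_smul_of_inner_eq_zero he hz r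
  have hee : ⟪e, e⟫ = 1 := by rw [real_inner_self_eq_norm_sq, he, one_pow]
  have hev : ⟪e, v⟫ = 0 := by rw [real_inner_comm]; exact hv
  simp only [oseenKernel, heatKernel_eq_of_norm_eq hn, oseenWeightA_eq_of_norm_eq hn,
    oseenWeightB_eq_of_norm_eq hn, inner_add_left, inner_sub_left, real_inner_smul_left, hz,
    hee, hev, real_inner_comm e a]
  ring

/-- An integrable function on `ℝ` whose reflection adds up with it to `2g` has the integral of
`g` (`∫ f(−r) dr = ∫ f(r) dr`). [folklore] -/
theorem integral_eq_of_comp_neg_add {F : Type*} [NormedAddCommGroup F] [NormedSpace ℝ F]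
    {f g : ℝ → F} (hf : Integrable f) (hfg : ∀ r, f (-r) + f r = (2 : ℝ) • g r) :
    ∫ r, f r = ∫ r, g r := by
  have h1 : ∫ r, f (-r) = ∫ r, f r := integral_neg_eq_self f volume
  have h2 : (∫ r, f (-r)) + ∫ r, f r = ∫ r, (2 : ℝ) • g r := by
    rw [← integral_add hf.comp_neg hf]
    exact integral_congr_ae (Eventually.of_forall hfg)
  rw [h1, integral_smul, ← two_smul ℝ (∫ r, f r)] at h2
  exact smul_right_injective F (two_ne_zero' ℝ) h2

variable [FiniteDimensional ℝ E] [MeasurableSpace E] [BorelSpace E]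

omit [MeasurableSpace E] [BorelSpace E] in
/-- A space containing a unit vector has positive dimension. [folklore] -/
theorem one_le_finrank_of_norm_eq_one (he : ‖e‖ = 1) : (1 : ℝ) ≤ (Module.finrank ℝ E : ℝ) := by
  have hne : e ≠ 0 := by
    rintro rfl
    rw [norm_zero] at he
    exact zero_ne_one he
  have : 0 < Module.finrank ℝ E := Module.finrank_pos_iff_exists_ne_zero.2 ⟨e, hne⟩
  exact_mod_cast this

/-- **The kernel is integrable along every line parallel to `e`**: for `σ > 0`, `z' ⊥ e`,
`r ↦ K(σ, z' + re)[a, b]` is integrable on `ℝ` (Koch–Tataru's bound (14):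
`‖K‖ ≤ C (σ + ‖z'‖² + r²)^{−(d+1)/2} ‖a‖‖b‖ ≤ C (σ + r²)^{−(d+1)/2} ‖a‖‖b‖`). [cite: KochTataruAdvMath2001, §3 (14)] -/
theorem integrable_oseenKernel_line (he : ‖e‖ = 1) (hz : ⟪z', e⟫ = 0) (hσ : 0 < σ) (a b : E) :
    Integrable fun r : ℝ => oseenKernel σ (z' + r • e) a b := by
  obtain ⟨C, hC, hK⟩ := exists_norm_oseenKernel_le (E := E)
  have hd := one_le_finrank_of_norm_eq_one he
  have hmeas : Measurable fun r : ℝ => oseenKernel σ (z' + r • e) a b :=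
    (measurable_oseenKernel_left σ a b).comp (by fun_prop)
  have hexp : -(((Module.finrank ℝ E : ℝ) + 1) / 2) ≤ 0 := by linarith
  have hdom : ∀ r : ℝ, ‖oseenKernel σ (z' + r • e) a b‖ ≤
      C * ‖a‖ * ‖b‖ * (σ + ‖r‖ ^ 2) ^ (-(((Module.finrank ℝ E : ℝ) + 1) / 2)) := by
    intro r
    have h2 : (σ + ‖z' + r • e‖ ^ 2) ^ (-(((Module.finrank ℝ E : ℝ) + 1) / 2)) ≤
        (σ + ‖r‖ ^ 2) ^ (-(((Module.finrank ℝ E : ℝ) + 1) / 2)) := by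
      refine Real.rpow_le_rpow_of_nonpos (by positivity) ?_ hexp
      rw [norm_add_smul_sq_of_inner_eq_zero he hz, Real.norm_eq_abs, sq_abs]
      nlinarith [sq_nonneg ‖z'‖]
    calc ‖oseenKernel σ (z' + r • e) a b‖
        ≤ C * (σ + ‖z' + r • e‖ ^ 2) ^ (-(((Module.finrank ℝ E : ℝ) + 1) / 2)) * ‖a‖ * ‖b‖ :=
          hK hσ _ a b
      _ ≤ C * (σ + ‖r‖ ^ 2) ^ (-(((Module.finrank ℝ E : ℝ) + 1) / 2)) * ‖a‖ * ‖b‖ := by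
          gcongr
      _ = C * ‖a‖ * ‖b‖ * (σ + ‖r‖ ^ 2) ^ (-(((Module.finrank ℝ E : ℝ) + 1) / 2)) := by ring
  have hw : Integrable (fun r : ℝ => (σ + ‖r‖ ^ 2) ^ (-(((Module.finrank ℝ E : ℝ) + 1) / 2))) :=
    integrable_add_norm_sq_rpow_neg (E := ℝ) (by rw [Module.finrank_self]; push_cast; linarith) hσ
  exact (hw.const_mul (C * ‖a‖ * ‖b‖)).mono' hmeas.aestronglyMeasurable (Eventually.of_forall hdom)

/-- **The kernel with its divergence slot along the line integrates to zero along the line**: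
`∫ K(σ, z' + re)[e, b] dr = 0` for every `b` (`σ > 0`, `z' ⊥ e`, `‖e‖ = 1`). This is the
vanishing of `e^{σΔ}P∇·(u ⊗ v)` for `u = w e` with `w`, `v` independent of the `e`-coordinate
(the divergence `∂_e(w v)` is zero) at the level of the closed kernel: the odd part in `r`
integrates to zero and the even part is `(A − r²B)(⟪e, b⟫z' + ⟪z', b⟫e)`, killed by the moment
identity `integral_oseenWeightA_sub_sq_mul_oseenWeightB_line`. [folklore] -/
theorem integral_oseenKernel_line_left (he : ‖e‖ = 1) (hz : ⟪z', e⟫ = 0) (hσ : 0 < σ) (b : E) :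
    ∫ r : ℝ, oseenKernel σ (z' + r • e) e b = 0 := by
  have hf := integrable_oseenKernel_line he hz hσ e b
  rw [integral_eq_of_comp_neg_add hf (g := fun r =>
    (oseenWeightA σ (z' + r • e) - r ^ 2 * oseenWeightB σ (z' + r • e)) •
      (⟪e, b⟫ • z' + ⟪z', b⟫ • e))
    (fun r => by rw [oseenKernel_line_reflect_add_left he hz σ r b, smul_smul])]
  rw [integral_smul_const, integral_oseenWeightA_sub_sq_mul_oseenWeightB_line he hz hσ, zero_smul]

/-- **The kernel with its transported slot along the line is parallel to the line after
integration along it**: `⟪∫ K(σ, z' + re)[a, e] dr, v⟫ = 0` for every `a` and every `v ⊥ e`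
(`σ > 0`, `z' ⊥ e`, `‖e‖ = 1`): `e^{σΔ}P∇·(u ⊗ (w e))` has no component orthogonal to `e` for
data independent of the `e`-coordinate. [folklore] -/
theorem inner_integral_oseenKernel_line_right (he : ‖e‖ = 1) (hz : ⟪z', e⟫ = 0) (hσ : 0 < σ)
    (a : E) {v : E} (hv : ⟪v, e⟫ = 0) :
    ⟪∫ r : ℝ, oseenKernel σ (z' + r • e) a e, v⟫ = 0 := by
  have hf := integrable_oseenKernel_line he hz hσ a e
  rw [real_inner_comm, ← integral_inner hf v]
  have hf' : Integrable fun r : ℝ => ⟪v, oseenKernel σ (z' + r • e) a e⟫ := hf.const_inner v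
  rw [integral_eq_of_comp_neg_add hf' (g := fun r => ⟪a, e⟫ * ⟪z', v⟫ *
    (oseenWeightA σ (z' + r • e) - r ^ 2 * oseenWeightB σ (z' + r • e)))
    (fun r => by
      rw [← inner_add_right, real_inner_comm,
        inner_oseenKernel_line_reflect_add_right he hz hv σ r a, smul_eq_mul])]
  rw [integral_const_mul, integral_oseenWeightA_sub_sq_mul_oseenWeightB_line he hz hσ, mul_zero]

end Kernel

/-! ## Lines parallel to the second coordinate axis of `ℝ³` -/

section R3

/- In this section `ℝ³ = EuclideanSpace ℝ (Fin 3)`, `ℝ² = EuclideanSpace ℝ (Fin 2)` and the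
unit vector of the ignorable coordinate is `e₁ = EuclideanSpace.single 1 1` (Lean index `1`;
KNSS's `x₂`); no notation is declared. -/

/-- `‖e₁‖ = 1`. [folklore] -/
theorem norm_single_one_one :
    ‖(EuclideanSpace.single (1 : Fin 3) (1 : ℝ) : EuclideanSpace ℝ (Fin 3))‖ = 1 := by
  simp

/-- `single 1 r = r • e₁`. [folklore] -/
theorem single_one_eq_smul (r : ℝ) :
    (EuclideanSpace.single (1 : Fin 3) r : EuclideanSpace ℝ (Fin 3)) =
      r • EuclideanSpace.single (1 : Fin 3) (1 : ℝ) := by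
  ext j
  fin_cases j <;> simp

/-- The point of the line through `(w₀, ·, w₁)` at height `r`:
`(w₀, r, w₁) = (w₀, 0, w₁) + r e₁`. [folklore] -/
theorem toLp_line_eq (r : ℝ) (w : EuclideanSpace ℝ (Fin 2)) :
    (toLp 2 ![w 0, r, w 1] : EuclideanSpace ℝ (Fin 3)) =
      toLp 2 ![w 0, 0, w 1] + r • EuclideanSpace.single (1 : Fin 3) (1 : ℝ) := by
  ext j
  fin_cases j <;> simp

/-- The base point `(w₀, 0, w₁)` is orthogonal to `e₁`. [folklore] -/
theorem inner_toLp_base_single (w : EuclideanSpace ℝ (Fin 2)) :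
    ⟪(toLp 2 ![w 0, 0, w 1] : EuclideanSpace ℝ (Fin 3)),
      EuclideanSpace.single (1 : Fin 3) (1 : ℝ)⟫ = 0 := by
  rw [EuclideanSpace.inner_single_right]
  simp

/-- **A volume-preserving parametrisation of `ℝ³` by the lines parallel to `e₁`**: there is a
measurable equivalence `Φ : ℝ³ ≃ ℝ × ℝ²` preserving Lebesgue measure with
`Φ⁻¹(r, w) = (w₀, r, w₁)` (Mathlib's `MeasurableEquiv.piFinSuccAbove` at the index `1`,
conjugated by the volume-preserving identifications `EuclideanSpace ℝ (Fin n) ≃ (Fin n → ℝ)`;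
cf. `cylSplit` of `CylindricalIntegration` at the index `2`). [folklore] -/
theorem exists_measurableEquiv_line :
    ∃ Φ : EuclideanSpace ℝ (Fin 3) ≃ᵐ ℝ × EuclideanSpace ℝ (Fin 2),
      MeasurePreserving Φ volume volume ∧
        ∀ (r : ℝ) (w : EuclideanSpace ℝ (Fin 2)), Φ.symm (r, w) = toLp 2 ![w 0, r, w 1] := by
  set Φ : EuclideanSpace ℝ (Fin 3) ≃ᵐ ℝ × EuclideanSpace ℝ (Fin 2) :=
    ((MeasurableEquiv.toLp 2 (Fin 3 → ℝ)).symm.trans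
      (MeasurableEquiv.piFinSuccAbove (fun _ => ℝ) 1)).trans
      (MeasurableEquiv.prodCongr (MeasurableEquiv.refl ℝ)
        (MeasurableEquiv.toLp 2 (Fin 2 → ℝ))) with hΦ
  have h1 : MeasurePreserving (MeasurableEquiv.toLp 2 (Fin 3 → ℝ)).symm volume volume :=
    EuclideanSpace.volume_preserving_symm_measurableEquiv_toLp (Fin 3)
  have h2 : MeasurePreserving (MeasurableEquiv.piFinSuccAbove (fun _ : Fin 3 => ℝ) 1) volume
      volume :=
    volume_preserving_piFinSuccAbove (fun _ => ℝ) 1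
  have h3 : MeasurePreserving
      (MeasurableEquiv.prodCongr (MeasurableEquiv.refl ℝ)
        (MeasurableEquiv.toLp 2 (Fin 2 → ℝ))) volume volume :=
    (MeasurePreserving.id volume).prod (PiLp.volume_preserving_toLp (Fin 2))
  refine ⟨Φ, (h1.trans h2).trans h3, fun r w => ?_⟩
  apply Φ.injective
  rw [MeasurableEquiv.apply_symm_apply]
  refine Prod.ext rfl ?_
  ext j
  fin_cases j <;> rfl

variable {F : Type*} [NormedAddCommGroup F] [NormedSpace ℝ F]

/-- **Fubini along the lines parallel to `e₁`**: `∫ G dx = ∫ dw ∫ dr G(w₀, r, w₁)` for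
integrable `G : ℝ³ → F`. [folklore] -/
theorem integral_eq_integral_integral_line {G : EuclideanSpace ℝ (Fin 3) → F}
    (hG : Integrable G) :
    ∫ x, G x = ∫ w : EuclideanSpace ℝ (Fin 2), ∫ r : ℝ, G (toLp 2 ![w 0, r, w 1]) := by
  obtain ⟨Φ, hΦ, hΦs⟩ := exists_measurableEquiv_line
  have hs : MeasurePreserving Φ.symm volume volume := hΦ.symm _
  have hi : Integrable (fun p : ℝ × EuclideanSpace ℝ (Fin 2) => G (Φ.symm p))
      ((volume : Measure ℝ).prod (volume : Measure (EuclideanSpace ℝ (Fin 2)))) :=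
    (hs.integrable_comp_emb Φ.symm.measurableEmbedding).2 hG
  rw [← hs.integral_comp Φ.symm.measurableEmbedding G,
    show (∫ w : EuclideanSpace ℝ (Fin 2), ∫ r : ℝ, G (toLp 2 ![w 0, r, w 1])) =
        ∫ w : EuclideanSpace ℝ (Fin 2), ∫ r : ℝ, G (Φ.symm (r, w)) by
      simp only [hΦs]]
  exact integral_prod_symm (fun p : ℝ × EuclideanSpace ℝ (Fin 2) => G (Φ.symm p)) hi

/-- The translate `x − (w₀, r, w₁)` decomposed along the line: with the base point
`z'(w) = x − (w₀, 0, w₁) − x₁e₁ ⊥ e₁`, `x − (w₀, r, w₁) = z'(w) + (x₁ − r)e₁`. [folklore] -/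
theorem sub_toLp_line_eq (x : EuclideanSpace ℝ (Fin 3)) (r : ℝ) (w : EuclideanSpace ℝ (Fin 2)) :
    x - toLp 2 ![w 0, r, w 1] =
      (x - toLp 2 ![w 0, 0, w 1] - x 1 • EuclideanSpace.single (1 : Fin 3) (1 : ℝ)) +
        (x 1 - r) • EuclideanSpace.single (1 : Fin 3) (1 : ℝ) := by
  rw [toLp_line_eq]
  module

/-- The base point `z'(w) = x − (w₀, 0, w₁) − x₁e₁` is orthogonal to `e₁`. [folklore] -/
theorem inner_sub_toLp_base_single (x : EuclideanSpace ℝ (Fin 3)) (w : EuclideanSpace ℝ (Fin 2)) :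
    ⟪x - toLp 2 ![w 0, 0, w 1] - x 1 • EuclideanSpace.single (1 : Fin 3) (1 : ℝ),
      EuclideanSpace.single (1 : Fin 3) (1 : ℝ)⟫ = 0 := by
  rw [inner_sub_left, inner_sub_left, real_inner_smul_left, inner_toLp_base_single,
    EuclideanSpace.inner_single_right, real_inner_self_eq_norm_sq, norm_single_one_one]
  simp

/-- **Integrability of the kernel against bounded fields** on `ℝ³`:
`y ↦ K(σ, x − y)[a(y), b(y)]` is integrable for `σ > 0` and bounded measurable `a`, `b`
(Koch–Tataru's bound (14) and `∫ (σ + ‖z‖²)^{−2} dz < ∞` in dimension three). [cite: KochTataruAdvMath2001, §3 (14)] -/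
theorem integrable_oseenKernel_sub_of_bounded {σ : ℝ} (hσ : 0 < σ)
    {a b : EuclideanSpace ℝ (Fin 3) → EuclideanSpace ℝ (Fin 3)}
    (ham : AEStronglyMeasurable a volume) (hbm : AEStronglyMeasurable b volume)
    {Ma Mb : ℝ} (ha : ∀ y, ‖a y‖ ≤ Ma) (hb : ∀ y, ‖b y‖ ≤ Mb) (x : EuclideanSpace ℝ (Fin 3)) :
    Integrable fun y : EuclideanSpace ℝ (Fin 3) => oseenKernel σ (x - y) (a y) (b y) := by
  obtain ⟨C, hC, hK⟩ := exists_norm_oseenKernel_le (E := EuclideanSpace ℝ (Fin 3))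
  have hd : (Module.finrank ℝ (EuclideanSpace ℝ (Fin 3)) : ℝ) = 3 := by simp
  have hMa : 0 ≤ Ma := (norm_nonneg _).trans (ha 0)
  have hMb : 0 ≤ Mb := (norm_nonneg _).trans (hb 0)
  have hmeas : AEStronglyMeasurable
      (fun y : EuclideanSpace ℝ (Fin 3) => oseenKernel σ (x - y) (a y) (b y)) volume := by
    refine (AEMeasurable.oseenKernel_comp aemeasurable_const ?_ ham.aemeasurable
      hbm.aemeasurable).aestronglyMeasurable
    exact (measurable_const.sub measurable_id).aemeasurable
  have hw : Integrable
      (fun y : EuclideanSpace ℝ (Fin 3) => (σ + ‖x - y‖ ^ 2) ^ (-(2 : ℝ))) := by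
    have h := integrable_add_norm_sq_rpow_neg (E := EuclideanSpace ℝ (Fin 3)) (e := 2)
      (by rw [hd]; norm_num) hσ
    exact h.comp_sub_left x
  refine (hw.const_mul (C * Ma * Mb)).mono' hmeas (Eventually.of_forall fun y => ?_)
  have h1 := hK hσ (x - y) (a y) (b y)
  rw [hd] at h1
  calc ‖oseenKernel σ (x - y) (a y) (b y)‖
      ≤ C * (σ + ‖x - y‖ ^ 2) ^ (-((3 + 1) / 2 : ℝ)) * ‖a y‖ * ‖b y‖ := h1
    _ ≤ C * (σ + ‖x - y‖ ^ 2) ^ (-((3 + 1) / 2 : ℝ)) * Ma * Mb := by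
        gcongr
        exacts [ha y, hb y]
    _ = C * Ma * Mb * (σ + ‖x - y‖ ^ 2) ^ (-(2 : ℝ)) := by norm_num; ring

/-- **The Oseen kernel integrated against line-invariant data, divergence slot along the
line, vanishes**: if `g : ℝ³ → ℝ` and `c : ℝ³ → ℝ³` are bounded, measurable and invariant under
the translations `y ↦ y + δe₁`, then `∫ K(σ, x − y)[g(y)e₁, c(y)] dy = 0` for every `x`
(`σ > 0`). This is `e^{σΔ}P∇·((g e₁) ⊗ c) = 0` for such tensors — the divergence `∂₁(g c)`
vanishes — at the level of the closed kernel: Fubini along the lines parallel to `e₁` and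
`integral_oseenKernel_line_left` on each line. [folklore] -/
theorem integral_oseenKernel_sub_smul_single_left {σ : ℝ} (hσ : 0 < σ)
    {g : EuclideanSpace ℝ (Fin 3) → ℝ} {c : EuclideanSpace ℝ (Fin 3) → EuclideanSpace ℝ (Fin 3)}
    (hgm : AEStronglyMeasurable g volume) (hcm : AEStronglyMeasurable c volume)
    {Mg Mc : ℝ} (hgb : ∀ y, |g y| ≤ Mg) (hcb : ∀ y, ‖c y‖ ≤ Mc)
    (hgi : ∀ (y : EuclideanSpace ℝ (Fin 3)) (δ : ℝ), g (y + EuclideanSpace.single 1 δ) = g y)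
    (hci : ∀ (y : EuclideanSpace ℝ (Fin 3)) (δ : ℝ), c (y + EuclideanSpace.single 1 δ) = c y)
    (x : EuclideanSpace ℝ (Fin 3)) :
    ∫ y, oseenKernel σ (x - y) (g y • EuclideanSpace.single (1 : Fin 3) (1 : ℝ)) (c y) = 0 := by
  have hint : Integrable fun y : EuclideanSpace ℝ (Fin 3) =>
      oseenKernel σ (x - y) (g y • EuclideanSpace.single (1 : Fin 3) (1 : ℝ)) (c y) := by
    refine integrable_oseenKernel_sub_of_bounded hσ
      (a := fun y => g y • EuclideanSpace.single (1 : Fin 3) (1 : ℝ)) ?_ hcm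
      (Ma := Mg) (fun y => ?_) hcb x
    · exact hgm.smul_const _
    · rw [norm_smul, norm_single_one_one, mul_one]; exact hgb y
  rw [integral_eq_integral_integral_line hint]
  refine integral_eq_zero_of_ae (Eventually.of_forall fun w => ?_)
  -- on the line through `(w₀, ·, w₁)`
  set p₀ : EuclideanSpace ℝ (Fin 3) := toLp 2 ![w 0, 0, w 1] with hp₀
  set z' : EuclideanSpace ℝ (Fin 3) :=
    x - p₀ - x 1 • EuclideanSpace.single (1 : Fin 3) (1 : ℝ) with hz'
  have hz : ⟪z', EuclideanSpace.single (1 : Fin 3) (1 : ℝ)⟫ = 0 :=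
    inner_sub_toLp_base_single x w
  have hline : ∀ r : ℝ, oseenKernel σ (x - toLp 2 ![w 0, r, w 1])
      (g (toLp 2 ![w 0, r, w 1]) • EuclideanSpace.single (1 : Fin 3) (1 : ℝ))
      (c (toLp 2 ![w 0, r, w 1])) =
        g p₀ • oseenKernel σ (z' + (x 1 - r) • EuclideanSpace.single (1 : Fin 3) (1 : ℝ))
          (EuclideanSpace.single (1 : Fin 3) (1 : ℝ)) (c p₀) := by
    intro r
    have hy : (toLp 2 ![w 0, r, w 1] : EuclideanSpace ℝ (Fin 3)) =
        p₀ + EuclideanSpace.single 1 r := by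
      rw [hp₀, toLp_line_eq, ← single_one_eq_smul]
    rw [sub_toLp_line_eq x r w, hy, hgi, hci, oseenKernel_smul_left]
  simp only [hline]
  show ∫ r : ℝ, g p₀ • oseenKernel σ (z' + (x 1 - r) • EuclideanSpace.single (1 : Fin 3) (1 : ℝ))
    (EuclideanSpace.single (1 : Fin 3) (1 : ℝ)) (c p₀) = 0
  rw [integral_smul, integral_sub_left_eq_self (fun r : ℝ =>
      oseenKernel σ (z' + r • EuclideanSpace.single (1 : Fin 3) (1 : ℝ))
        (EuclideanSpace.single (1 : Fin 3) (1 : ℝ)) (c p₀)) volume (x 1),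
    integral_oseenKernel_line_left norm_single_one_one hz hσ (c p₀), smul_zero]

/-- **The Oseen kernel integrated against line-invariant data, transported slot along the
line, is parallel to the line**: if `a : ℝ³ → ℝ³` and `g : ℝ³ → ℝ` are bounded, measurable and
invariant under `y ↦ y + δe₁`, then `⟪∫ K(σ, x − y)[a(y), g(y)e₁] dy, v⟫ = 0` for every `x`
and every `v ⊥ e₁` (`σ > 0`): `e^{σΔ}P∇·(a ⊗ g e₁)` has no component orthogonal to `e₁`
(Fubini along the lines and `inner_integral_oseenKernel_line_right`). [folklore] -/
theorem inner_integral_oseenKernel_sub_smul_single_right {σ : ℝ} (hσ : 0 < σ)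
    {a : EuclideanSpace ℝ (Fin 3) → EuclideanSpace ℝ (Fin 3)} {g : EuclideanSpace ℝ (Fin 3) → ℝ}
    (ham : AEStronglyMeasurable a volume) (hgm : AEStronglyMeasurable g volume)
    {Ma Mg : ℝ} (hab : ∀ y, ‖a y‖ ≤ Ma) (hgb : ∀ y, |g y| ≤ Mg)
    (hai : ∀ (y : EuclideanSpace ℝ (Fin 3)) (δ : ℝ), a (y + EuclideanSpace.single 1 δ) = a y)
    (hgi : ∀ (y : EuclideanSpace ℝ (Fin 3)) (δ : ℝ), g (y + EuclideanSpace.single 1 δ) = g y)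
    (x : EuclideanSpace ℝ (Fin 3)) {v : EuclideanSpace ℝ (Fin 3)}
    (hv : ⟪v, EuclideanSpace.single (1 : Fin 3) (1 : ℝ)⟫ = 0) :
    ⟪∫ y, oseenKernel σ (x - y) (a y) (g y • EuclideanSpace.single (1 : Fin 3) (1 : ℝ)), v⟫ =
      0 := by
  have hint : Integrable fun y : EuclideanSpace ℝ (Fin 3) =>
      oseenKernel σ (x - y) (a y) (g y • EuclideanSpace.single (1 : Fin 3) (1 : ℝ)) := by
    refine integrable_oseenKernel_sub_of_bounded hσ
      (b := fun y => g y • EuclideanSpace.single (1 : Fin 3) (1 : ℝ)) ham ?_ hab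
      (Mb := Mg) (fun y => ?_) x
    · exact hgm.smul_const _
    · rw [norm_smul, norm_single_one_one, mul_one]; exact hgb y
  rw [real_inner_comm, ← integral_inner hint v,
    integral_eq_integral_integral_line (hint.const_inner v)]
  refine integral_eq_zero_of_ae (Eventually.of_forall fun w => ?_)
  set p₀ : EuclideanSpace ℝ (Fin 3) := toLp 2 ![w 0, 0, w 1] with hp₀
  set z' : EuclideanSpace ℝ (Fin 3) :=
    x - p₀ - x 1 • EuclideanSpace.single (1 : Fin 3) (1 : ℝ) with hz'
  have hz : ⟪z', EuclideanSpace.single (1 : Fin 3) (1 : ℝ)⟫ = 0 :=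
    inner_sub_toLp_base_single x w
  have hline : ∀ r : ℝ, oseenKernel σ (x - toLp 2 ![w 0, r, w 1]) (a (toLp 2 ![w 0, r, w 1]))
      (g (toLp 2 ![w 0, r, w 1]) • EuclideanSpace.single (1 : Fin 3) (1 : ℝ)) =
        g p₀ • oseenKernel σ (z' + (x 1 - r) • EuclideanSpace.single (1 : Fin 3) (1 : ℝ))
          (a p₀) (EuclideanSpace.single (1 : Fin 3) (1 : ℝ)) := by
    intro r
    have hy : (toLp 2 ![w 0, r, w 1] : EuclideanSpace ℝ (Fin 3)) =
        p₀ + EuclideanSpace.single 1 r := by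
      rw [hp₀, toLp_line_eq, ← single_one_eq_smul]
    rw [sub_toLp_line_eq x r w, hy, hai, hgi, oseenKernel_smul_right]
  simp only [hline]
  show ∫ r : ℝ, ⟪v, g p₀ •
    oseenKernel σ (z' + (x 1 - r) • EuclideanSpace.single (1 : Fin 3) (1 : ℝ)) (a p₀)
      (EuclideanSpace.single (1 : Fin 3) (1 : ℝ))⟫ = 0
  have hfi : Integrable fun r : ℝ => g p₀ •
      oseenKernel σ (z' + (x 1 - r) • EuclideanSpace.single (1 : Fin 3) (1 : ℝ)) (a p₀)
        (EuclideanSpace.single (1 : Fin 3) (1 : ℝ)) :=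
    ((integrable_oseenKernel_line norm_single_one_one hz hσ (a p₀)
      (EuclideanSpace.single (1 : Fin 3) (1 : ℝ))).comp_sub_left (x 1)).smul (g p₀)
  rw [integral_inner hfi v, integral_smul, integral_sub_left_eq_self (fun r : ℝ =>
      oseenKernel σ (z' + r • EuclideanSpace.single (1 : Fin 3) (1 : ℝ)) (a p₀)
        (EuclideanSpace.single (1 : Fin 3) (1 : ℝ))) volume (x 1),
    inner_smul_right, real_inner_comm,
    inner_integral_oseenKernel_line_right norm_single_one_one hz hσ (a p₀) hv, mul_zero]

end R3

end Literature.Analysis.FluidPDE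

end
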